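import Mathlib
import HarnessLib
import Literature.Computability.AlgebraicComplexity.MonotoneStructure

/-!
# ValiantsHypothesis / MonotoneRestoration — `MonotoneRestorationQP`, line `Sketch`, stub G4b

Support file for crux item `stmt-ValiantsHypothesis-15886`
(`Summit.ValiantsHypothesis.ValiantsHypothesis.Theses.MonotoneRestoration.MonotoneRestorationQP`),
line `Sketch`, stub `stub_esymmRowSums_structure` (structure of the witness of Theorem γ).

The witness is `E_n = e_{⌊n/2⌋}(R₁, …, R_n)`, the elementary symmetric polynomial of degree
`⌊n/2⌋` in the row sums `R_i = Σ_j x_{i,j}` of the `n × n` matrix of variables, over the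
semiring `ℝ≥0`. Expanding `esymm` gives `E_n = Σ_{|t| = ⌊n/2⌋} ∏_{i ∈ t} R_i`
(`esymmRowSumsStructure_eq_sum`), from which:

1. `E_n` is homogeneous of degree `⌊n/2⌋` (each `R_i` is homogeneous of degree `1`);
2. `E_n` is row-multilinear: every monomial of `∏_{i ∈ t} R_i` has row degrees bounded by the
   indicator of `t` (induction on `t`, `support_mul ⊆` Minkowski sum, `support_X`);
3. `E_n ≠ 0`: its value at the all-ones matrix is `Σ_{|t| = ⌊n/2⌋} n^{|t|} > 0`;
4. `E_n` is invariant under independent row and column permutations: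
   `rename (σ × τ) (bind₁ R e) = bind₁ (R ∘ σ) e = bind₁ R (rename σ e)` and `esymm` is
   symmetric (`MvPolynomial.rename_esymm`).
-/

-- `Summit.ValiantsHypothesis.ValiantsHypothesis.…` is the tree's mandated single-conjunct layout
-- (Sub = Summit), so the duplicated namespace component is intended.
set_option linter.dupNamespace false

noncomputable section

namespace Summit.ValiantsHypothesis.ValiantsHypothesis.Theorems

open Literature.Computability.AlgebraicComplexity MvPolynomial
open scoped NNReal

/-- `e_k` of the row sums, expanded: `e_k(R₁, …, R_n) = Σ_{|t| = k} ∏_{i ∈ t} Σ_j x_{i,j}`.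
[folklore] -/
theorem esymmRowSumsStructure_eq_sum (n k : ℕ) :
    bind₁ (fun i : Fin n => ∑ j : Fin n, (X (i, j) : MvPolynomial (Fin n × Fin n) ℝ≥0))
        (esymm (Fin n) ℝ≥0 k) =
      ∑ t ∈ Finset.powersetCard k Finset.univ, ∏ i ∈ t, ∑ j : Fin n, X (i, j) := by
  simp only [esymm, map_sum, map_prod, bind₁_X_right]

/-- `e_k` of the row sums is homogeneous of degree `k`. [folklore] -/
theorem esymmRowSumsStructure_isHomogeneous (n k : ℕ) :
    (bind₁ (fun i : Fin n => ∑ j : Fin n, (X (i, j) : MvPolynomial (Fin n × Fin n) ℝ≥0))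
        (esymm (Fin n) ℝ≥0 k)).IsHomogeneous k := by
  rw [esymmRowSumsStructure_eq_sum]
  refine IsHomogeneous.sum _ _ _ fun t ht => ?_
  have hcard : ∑ i ∈ t, (1 : ℕ) = k := by
    rw [Finset.sum_const, smul_eq_mul, mul_one]
    exact (Finset.mem_powersetCard.1 ht).2
  rw [← hcard]
  exact IsHomogeneous.prod t _ (fun _ => 1)
    fun i _ => IsHomogeneous.sum _ _ _ fun j _ => isHomogeneous_X _ _

/-- Every monomial of `∏_{i ∈ t} R_i`, `R_i = Σ_j x_{i,j}`, has row degrees bounded by the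
indicator of `t` (over `ℝ≥0`, or indeed over any semiring). [folklore] -/
theorem esymmRowSumsStructure_rowDegrees_prod_le (n : ℕ) (t : Finset (Fin n)) :
    ∀ m ∈ (∏ i ∈ t, ∑ j : Fin n, (X (i, j) : MvPolynomial (Fin n × Fin n) ℝ≥0)).support,
      ∀ i : Fin n, rowDegrees m i ≤ if i ∈ t then 1 else 0 := by
  classical
  induction t using Finset.induction_on with
  | empty =>
    intro m hm i
    rw [Finset.prod_empty, support_one, Finset.mem_singleton] at hm
    simp [hm]
  | insert a t ha ih =>
    intro m hm i
    rw [Finset.prod_insert ha] at hm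
    obtain ⟨m₁, hm₁, m₂, hm₂, rfl⟩ := Finset.mem_add.1 (support_mul _ _ hm)
    obtain ⟨j, -, hj⟩ := Finset.mem_biUnion.1 (support_sum hm₁)
    rw [support_X, Finset.mem_singleton] at hj
    subst hj
    have h₂ := ih m₂ hm₂ i
    rw [rowDegrees_add, rowDegrees_single, Finsupp.add_apply]
    by_cases hi : i = a
    · subst hi
      rw [if_neg ha] at h₂
      rw [Finsupp.single_eq_same, if_pos (Finset.mem_insert_self _ _)]
      omega
    · rw [Finsupp.single_eq_of_ne hi, zero_add]
      simpa [Finset.mem_insert, hi] using h₂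

/-- `e_k` of the row sums is row-multilinear: every monomial uses each row at most once.
[folklore] -/
theorem esymmRowSumsStructure_rowDegrees_le (n k : ℕ) :
    ∀ m ∈ (bind₁ (fun i : Fin n => ∑ j : Fin n, (X (i, j) : MvPolynomial (Fin n × Fin n) ℝ≥0))
        (esymm (Fin n) ℝ≥0 k)).support, ∀ i : Fin n, rowDegrees m i ≤ 1 := by
  classical
  intro m hm i
  rw [esymmRowSumsStructure_eq_sum] at hm
  obtain ⟨t, -, ht⟩ := Finset.mem_biUnion.1 (support_sum hm)
  exact (esymmRowSumsStructure_rowDegrees_prod_le n t m ht i).trans (by split_ifs <;> simp)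

/-- `e_k` of the row sums is nonzero for `k ≤ n`: its value at the all-ones matrix is
`Σ_{|t| = k} n^{|t|} > 0`. [folklore] -/
theorem esymmRowSumsStructure_ne_zero (n k : ℕ) (hk : k ≤ n) :
    bind₁ (fun i : Fin n => ∑ j : Fin n, (X (i, j) : MvPolynomial (Fin n × Fin n) ℝ≥0))
        (esymm (Fin n) ℝ≥0 k) ≠ 0 := by
  intro h
  have h1 := congrArg (eval fun _ : Fin n × Fin n => (1 : ℝ≥0)) h
  rw [esymmRowSumsStructure_eq_sum, map_zero, map_sum] at h1
  refine absurd h1 (ne_of_gt (Finset.sum_pos (fun t _ => ?_) ?_))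
  · rw [map_prod]
    refine Finset.prod_pos fun i _ => ?_
    rw [map_sum]
    simp only [eval_X, Finset.sum_const, Finset.card_univ, Fintype.card_fin, nsmul_eq_mul,
      mul_one]
    exact Nat.cast_pos.2 (Fin.pos i)
  · exact Finset.powersetCard_nonempty.2 (by simpa using hk)

/-- `e_k` of the row sums is invariant under independent row and column permutations.
[folklore] -/
theorem esymmRowSumsStructure_rename (n k : ℕ) (σ τ : Equiv.Perm (Fin n)) :
    rename (fun p : Fin n × Fin n => (σ p.1, τ p.2))
        (bind₁ (fun i : Fin n => ∑ j : Fin n, (X (i, j) : MvPolynomial (Fin n × Fin n) ℝ≥0))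
          (esymm (Fin n) ℝ≥0 k)) =
      bind₁ (fun i : Fin n => ∑ j : Fin n, (X (i, j) : MvPolynomial (Fin n × Fin n) ℝ≥0))
        (esymm (Fin n) ℝ≥0 k) := by
  rw [rename_bind₁]
  have h : (fun i : Fin n => rename (fun p : Fin n × Fin n => (σ p.1, τ p.2))
      (∑ j : Fin n, (X (i, j) : MvPolynomial (Fin n × Fin n) ℝ≥0))) =
      (fun i : Fin n => ∑ j : Fin n, (X (i, j) : MvPolynomial (Fin n × Fin n) ℝ≥0)) ∘ σ := by
    funext i
    simp only [map_sum, rename_X, Function.comp_apply]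
    exact Equiv.sum_comp τ (fun j => (X (σ i, j) : MvPolynomial (Fin n × Fin n) ℝ≥0))
  rw [h, ← bind₁_rename, rename_esymm]

/-- **G4b — the witness `e_{⌊n/2⌋}(R₁,…,R_n)`: structure.** The elementary symmetric polynomial
of degree `⌊n/2⌋` in the row sums `R_i = Σ_j x_{i,j}` of the `n × n` variable matrix, over
`ℝ≥0`, is homogeneous of degree `⌊n/2⌋`, row-multilinear (every monomial uses each row at most
once), nonzero, and invariant under independent row and column permutations (`esymm` is
symmetric; `bind₁` along `X i ↦ Σ_j X (i,j)`). [folklore] -/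
theorem stub_esymmRowSums_structure (n : ℕ) :
    (MvPolynomial.bind₁ (fun i : Fin n => ∑ j : Fin n, MvPolynomial.X (i, j))
        (MvPolynomial.esymm (Fin n) NNReal (n / 2))).IsHomogeneous (n / 2) ∧
    (∀ m ∈ (MvPolynomial.bind₁ (fun i : Fin n => ∑ j : Fin n, MvPolynomial.X (i, j))
        (MvPolynomial.esymm (Fin n) NNReal (n / 2))).support, ∀ i : Fin n, rowDegrees m i ≤ 1) ∧
    (MvPolynomial.bind₁ (fun i : Fin n => ∑ j : Fin n, MvPolynomial.X (i, j))
        (MvPolynomial.esymm (Fin n) NNReal (n / 2)) ≠ 0) ∧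
    (∀ σ τ : Equiv.Perm (Fin n),
      MvPolynomial.rename (fun p : Fin n × Fin n => (σ p.1, τ p.2))
        (MvPolynomial.bind₁ (fun i : Fin n => ∑ j : Fin n, MvPolynomial.X (i, j))
          (MvPolynomial.esymm (Fin n) NNReal (n / 2))) =
      MvPolynomial.bind₁ (fun i : Fin n => ∑ j : Fin n, MvPolynomial.X (i, j))
        (MvPolynomial.esymm (Fin n) NNReal (n / 2))) :=
  ⟨esymmRowSumsStructure_isHomogeneous n (n / 2), esymmRowSumsStructure_rowDegrees_le n (n / 2),
    esymmRowSumsStructure_ne_zero n (n / 2) (Nat.div_le_self n 2),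
    esymmRowSumsStructure_rename n (n / 2)⟩

end Summit.ValiantsHypothesis.ValiantsHypothesis.Theorems

end
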